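import Literature.MathematicalPhysics.QuantumFieldTheory.Balaban1983to89.B8Prop5JoinSectELocal

/-!
# `Balaban1983to89.B8LeafModelZdSockLetters` — [Balaban1985RegularSpaces] Sect. D (1.91)–(1.103) pp. 91–93: THE [4]-LETTERS SOCKET of the N05 knit on the
# general-background `ℤᵈ × 𝔸` family — the letters `G′, Δ, Q′, Q′ᵀ, 𝔄, C, H′` of [Balaban1985BackgroundPropagators] with their projection laws, readings, Dirichlet
# range, reality and the bounds (1.92), (1.98), (1.101), quantified over the member's backgrounds and truncations, AS ONE NAMED `Prop`

statement-level skeleton of published theorems with citation tags; proofs where landed; nothing here is a claim about the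
Yang–Mills mass gap

PDF held: `paper:balaban1985-cmp99-regular-spaces-gauge-fixing` (journal page = PDF page + 74); pp. 91–94 ((1.86)–(1.106)).  [4] = [Balaban1985BackgroundPropagators]
(Thms 3.1–3.3 pp. 397–398, (3.23) p. 394).

WHY THIS FILE (cell `pub-ymgap`, R134 acceleration seat `pub-ymgap-dag-n05-d`, strategy s2 of DAG node N05 = [B8]; dag-lead REBALANCE №51 (ii): the (δ) LETTERS
pass-through of the `SockHFP` adapter; count-neutral).  The Sect. D/E JOIN `B8Prop5JoinSectELocal.hFP_kLevel_of_sectE_local'` (and its datum-level instantiation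
`B8SockHFPAssembly.sockHFP_body_of_join`) display [4]'s operators as LETTERS — `ℂ`-linear maps `g = G′` ((1.95), the inverse of `Δ + Q′ᵀ𝔄Q′` with Dirichlet conditions),
`Δ`, `q = Q′`, `qs = Q′ᵀ`, `Aw = 𝔄`, `c = C` ((1.96)–(1.97)), `H′` ((1.92), the operator of [4] Thm 3.2 solving `Q′(H′X) = X`) — with SEVENTEEN laws: the three
projection identities, the three readings (`Δ` IS the covariant Laplacian (1.2) on `Ω₀`-supported functions, `Q′ᵀ` IS `QT`, `Q′` IS the iterated average `QprimeIter`),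
(1.92) for `H′` (sup, `(−1)`-weighted gradient on the sides touching `Ω_j`, `(−2)`-weighted Laplacian), Dirichlet range and reality of `H′`, `Q′H′ = 1`, (1.101) for `G′`
(constant `B_G`), Dirichlet range and reality of `G′`, (1.98) for `R = 1 − G′Q′ᵀCQ′G′` (constant `B_R`) and reality of `R`.  These are THEOREMS of [4] (Thms 3.1–3.3)
for Bałaban's operators, NOT proved in the tree for those operators (the b9 ↦ N05 letters content; ref-A g7 WATCH: «no zero-junk model»).  THIS FILE names the
package, quantified the way the knit consumes it — for every regularity `α₀` below a threshold, every unitary background `U₀ ∈ 𝔄_k({Ω_j}, α₀)` of the member and every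
truncation level `1 ≤ n ≤ k` (structure `Λs n`) — so that the knit carries ONE hypothesis `SockLetters …` per member in place of the fixed-point sockets
`SockHFP₀`/`SockHFP` (which `B8SockHFPAssembly` + the windows then PROVE from it).

HONEST SCOPE.  A definition (a `Prop`), nothing else; nothing of [4] is asserted or proved.  Count-neutral; N05 NOT discharged; one finite T⁴ programme at
fixed ε; nothing continuum / ℝ⁴ / OS / mass-gap / Clay.  Unit `pub-ymgap-dag-n05-d` (g0), 2026-08-26.  No `instance`, no `notation`.
-/

noncomputable section

open NormedSpace

namespace Literature.MathematicalPhysics.QuantumFieldTheory.Balaban1983to89.B8LeafModelZdSockLetters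

open B7Prop2Explicit (unitaryUnits)
open B7Eq78Linearization (zdBlocking QprimeIter)
open B8Ineq132 (covDerivFwd InAk)
open B8Eq119TwistedAxial (bgT)
open B8Eq140Level (SideTouches)
open B8Eq138LandauZd (covLap QT)
open B8Eq1117Concrete (XSpace)
open B8Prop5ContractionKLevel (Bd2)
open B8LambdaSpaceKLevel (wt)

variable {d : ℕ}

section Letters

variable {𝔸 : Type*} [CStarAlgebra 𝔸]

/-- **THE [4]-LETTERS SOCKET** of the N05 knit at a member `(η, k, {Ω_j}, {Λs n})` of the general-background `ℤᵈ × 𝔸` family, constants `B_G` ((1.101)), `B_R` ((1.98)),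
`B₀′_H`, `B₂′` ((1.92)), threshold `cP`: for every `0 < α₀ ≤ cP`, every unitary background `U₀ ∈ 𝔄_k({Ω_j}, α₀)` and every truncation level `1 ≤ n ≤ k` there are
`ℂ`-linear LETTERS `g = G′`, `Δ`, `q = Q′`, `qs = Q′ᵀ`, `Aw = 𝔄`, `c = C`, `H′ : X_n → (ℤᵈ → 𝔸)` with: the projection laws `G′(Δ + Q′ᵀ𝔄Q′) = 1 = (Δ + Q′ᵀ𝔄Q′)G′`,
`Q′G′G′Q′ᵀC = 1`; the readings «`Δ` is the covariant Laplacian on `Ω₀`-supported functions», «`Q′ᵀ` is `QT` at `(n, Λs n)`», «`Q′` is the iterated average at the tower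
sites of `Λs n`»; (1.92) for `H′` (`|H′X| ≤ B₀′_H‖X‖`, `Lʲη|∇H′X| ≤ B₀′_H‖X‖` on the sides of the plaquettes touching `Ω_j`, `|ΔH′X|₍₋₂₎ ≤ B₂′‖X‖`), `H′X = 0` off `Ω₀`,
reality of `H′`, `Q′H′X = X` at the tower sites; (1.101) for `G′` (sup and weighted gradient `≤ B_G·m` for `|f|₍₋₂₎ ≤ m`), `G′f = 0` off `Ω₀`, reality of `G′`;
(1.98) for `R = 1 − G′Q′ᵀCQ′G′` (`|Rf|₍₋₂₎ ≤ B_R·m`) and reality of `R` — EXACTLY the letter binders of `B8Prop5JoinSectELocal.hFP_kLevel_of_sectE_local'` at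
`(k := n, Λs := Λs n, Eb j := {b ∣ SideTouches (Ω j) b})`.  [4] Thms 3.1–3.3 for Bałaban's operators, as ONE hypothesis per member; nothing asserted.
[cite: Balaban1985RegularSpaces, (1.91)–(1.92) p.91, (1.95)–(1.98) p.92, (1.101)–(1.103) p.93; Balaban1985BackgroundPropagators, Thms 3.1–3.3 pp.397–398] -/
def SockLetters (L : ℕ) (BG BR B₀'H B₂' cP : ℝ) (η : ℝ) (k : ℕ) (Ω : ℕ → Set (B7Prop1Explicit.Site d)) (Λs : ℕ → ℕ → Set (B7Prop1Explicit.Site d)) : Prop :=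
  ∀ α₀ : ℝ, 0 < α₀ → α₀ ≤ cP → ∀ U₀ : B7Prop1Explicit.Site d → Fin d → 𝔸ˣ, (∀ x κ, U₀ x κ ∈ unitaryUnits 𝔸) → InAk L k η α₀ Ω U₀ →
    ∀ n : ℕ, 1 ≤ n → n ≤ k →
      ∃ (g Δ : (B7Prop1Explicit.Site d → 𝔸) →ₗ[ℂ] (B7Prop1Explicit.Site d → 𝔸)) (q : (B7Prop1Explicit.Site d → 𝔸) →ₗ[ℂ] (ℕ → B7Prop1Explicit.Site d → 𝔸)) (qs : (ℕ → B7Prop1Explicit.Site d → 𝔸) →ₗ[ℂ] (B7Prop1Explicit.Site d → 𝔸))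
        (Aw c : (ℕ → B7Prop1Explicit.Site d → 𝔸) →ₗ[ℂ] (ℕ → B7Prop1Explicit.Site d → 𝔸)) (H' : XSpace d n 𝔸 →ₗ[ℂ] (B7Prop1Explicit.Site d → 𝔸)),
        (∀ x, g (Δ x + qs (Aw (q x))) = x) ∧ (∀ x, Δ (g x) + qs (Aw (q (g x))) = x) ∧ (∀ φ, q (g (g (qs (c φ)))) = φ) ∧
        (∀ (f : B7Prop1Explicit.Site d → 𝔸), ∀ x ∈ Ω 0, Δ f x = covLap η U₀ ((Ω 0).indicator f) x) ∧
        (∀ (μ : ℕ → B7Prop1Explicit.Site d → 𝔸), ∀ x ∈ Ω 0, qs μ x = QT L n (Λs n) U₀ μ x) ∧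
        (∀ (f : B7Prop1Explicit.Site d → 𝔸) (j : ℕ), j ≤ n → ∀ y ∈ Λs n j, q f j y = QprimeIter (zdBlocking d L) (bgT L U₀) j f y) ∧
        (∀ (X : XSpace d n 𝔸) (x : B7Prop1Explicit.Site d), ‖H' X x‖ ≤ B₀'H * ‖X‖) ∧
        (∀ j, j ≤ n → ∀ (X : XSpace d n 𝔸), ∀ p ∈ {b : B7Prop1Explicit.Site d × Fin d | SideTouches (Ω j) b.1 b.2},
          wt L η j * ‖covDerivFwd η U₀ p.2 (H' X) p.1‖ ≤ B₀'H * ‖X‖) ∧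
        (∀ X : XSpace d n 𝔸, Bd2 L η n Ω (covLap η U₀ (H' X)) (B₂' * ‖X‖)) ∧
        (∀ (X : XSpace d n 𝔸) (x : B7Prop1Explicit.Site d), x ∉ Ω 0 → H' X x = 0) ∧
        (∀ X Y : XSpace d n 𝔸, (∀ p, Y p = -star (X p)) → ∀ x, H' Y x = -star (H' X x)) ∧
        (∀ (Y : XSpace d n 𝔸) (j : ℕ) (hj : j ≤ n) (y : B7Prop1Explicit.Site d), y ∈ Λs n j →
          QprimeIter (zdBlocking d L) (bgT L U₀) j (H' Y) y = Y (⟨j, Nat.lt_succ_of_le hj⟩, y)) ∧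
        (∀ (f : B7Prop1Explicit.Site d → 𝔸) (r : ℝ), 0 ≤ r → Bd2 L η n Ω f r →
          (∀ x, ‖g f x‖ ≤ BG * r) ∧ ∀ j, j ≤ n → ∀ p ∈ {b : B7Prop1Explicit.Site d × Fin d | SideTouches (Ω j) b.1 b.2},
            wt L η j * ‖covDerivFwd η U₀ p.2 (g f) p.1‖ ≤ BG * r) ∧
        (∀ (f : B7Prop1Explicit.Site d → 𝔸) (x : B7Prop1Explicit.Site d), x ∉ Ω 0 → g f x = 0) ∧
        (∀ f : B7Prop1Explicit.Site d → 𝔸, (∀ j, j ≤ n → ∀ x ∈ Ω j, IsSelfAdjoint (f x)) → ∀ x, IsSelfAdjoint (g f x)) ∧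
        (∀ (f : B7Prop1Explicit.Site d → 𝔸) (r : ℝ), 0 ≤ r → Bd2 L η n Ω f r → Bd2 L η n Ω (f - g (qs (c (q (g f))))) (BR * r)) ∧
        (∀ f : B7Prop1Explicit.Site d → 𝔸, (∀ j, j ≤ n → ∀ x ∈ Ω j, IsSelfAdjoint (f x)) →
          ∀ j, j ≤ n → ∀ x ∈ Ω j, IsSelfAdjoint ((f - g (qs (c (q (g f))))) x))

end Letters

end Literature.MathematicalPhysics.QuantumFieldTheory.Balaban1983to89.B8LeafModelZdSockLetters

end
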